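import Literature.NumberTheory.EllipticCurves.SexticTwistThetaDictionaryInert
import Literature.NumberTheory.EllipticCurves.SexticTwistThetaDictionaryGoodTwo
import HarnessLib

/-!
# The `5`-part of the theta coefficient of `y² = x³ + 16u`, `u ≡ 1 (4)`: `Φ_u = (γ/5)₆^{v₅(u)} · Φ_{u₁}` (good-at-`2` class)

Topic `Literature/NumberTheory/EllipticCurves`, namespace `Literature.NumberTheory.EllipticCurves.SexticTwist` (sequel to
`SexticTwistThetaDictionaryInert` — every other sixth-power-free `k` — and `SexticTwistThetaDictionaryGoodTwo`).  Theorems only.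

Same statements and proofs as `SexticTwistThetaDictionaryInert` with the symbol parameter `4k` replaced by `u = k/16` (and `4k₁` by
`u₁ = u/5^e`); the one new input is `jacobiSym_five_absNorm_eq_of_not_mem` — `(5/N α) = e((α/5)₆)³` for EVERY `5 ∤ α` (even norms
included, via `(5/N α) = (N α/5)`, `jacobiSym_absNorm_flip`).  Main result ★ `lSeries_twist_eq_thetaLFunction_five_good`: for `k = 16u`,
`u ≡ 1 (4)`, `5 ∣ u`, sixth-power-free: `Σ c(n) a_n(E^k) n⁻ˢ = (4^s/2) · Θ-L_{2·5M′}(parityLift (y ↦ Φ₅(y₂, y₁ + y₂) Ψ(y)))(s)`, `M′ = 36|u₁|m`,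
with `Φ₅` the sextic character of `(ℤ/5)²` in `ρ`-coordinates (multiplicative, `Φ₅(0) = 0`, `Φ₅(−1, 1) = (−ρ²)^e`) and `Ψ = Φ′_{u₁}` periodic
modulo `M′` — the `hdict` input of the BED assembly for this class.  Nothing about BSD is proved here.

## References
* K. Ireland, M. Rosen, *A Classical Introduction to Modern Number Theory*, 2nd ed., GTM 84 (1990), Ch. 18 §7, §5 Theorem 6; Ch. 9 §3;
  Ch. 14 §2. [IrelandRosen1990] [IrelandRosen1982]
* E. Hecke, *Eine neue Art von Zetafunktionen …* II, Math. Z. 6 (1920), §9. [Hecke1920]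

## Mathlib / tree search
Tree: `SexticTwist.{weight_five_split, sexticCharFive_props, mk_mkInt_eq_of_emod_eq, embC_sexticResidueSymbol_tau, grossenNu_mul_left/_pow_left,
psi_five_eq_cubicResidueSymbol_primGen, isCoprime_span_five_pow, adm_of_adm_mul_left, two_three_not_mem_of_five_mem, residueCard_eq_of_five_mem,
charP_five, mk_absNorm_eq_pow_six, not_five_dvd_absNorm, jacobiSym_absNorm_flip, weight_periodic_good, isIntegral_weight_good,
sum_normEq_weight_good_eq, lSeries_coeff_parityLift}`; `sexticResidueSymbol_*`; `BinaryTheta.thetaLFunction_eq_LSeries`, `QuadOrder.parityLift_periodic`.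
-/

noncomputable section

open scoped Classical ComplexConjugate

open NumberField IsDedekindDomain Finset Complex
open Literature.NumberTheory.NumberFields Literature.NumberTheory.NumberFields.K3
open Literature.NumberTheory.GaloisRepresentations
open Literature.NumberTheory.LFunctions Literature.NumberTheory.LFunctions.NumberField
open Literature.NumberTheory.LFunctions.EisensteinGrossen Literature.NumberTheory.LFunctions.PlaneLattice

namespace Literature.NumberTheory.EllipticCurves

namespace SexticTwist

section Split

variable {v₅ : HeightOneSpectrum (𝓞 K3)} (hv : ((5 : ℤ) : 𝓞 K3) ∈ v₅.asIdeal)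
include hv

/-- **`(5/N α) = e((α/5)₆)³` for every `α ∈ ℤ[ω]` with `5 ∤ α`** (also for even norm `N α = 4^a n′`: `(5/N α) = (N α/5)` by
`jacobiSym_absNorm_flip`),
Euler's criterion `(N α/5) ≡ (N α)² (mod 5)`, `N α ≡ α⁶` and `(α/5)₆³ ≡ α¹² (mod 5)`, both sides `±1`.
[cite: IrelandRosen1982, Ch. 14 §2, Prop. 14.2.2] [cite: IrelandRosen1990, Ch. 5 §2 Theorem 1 (quadratic reciprocity)] -/
theorem jacobiSym_five_absNorm_eq_of_not_mem {α : 𝓞 K3} (hα : α ∉ v₅.asIdeal) :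
    (jacobiSym 5 (Ideal.absNorm (Ideal.span {α})) : ℂ) =
      embC ((sexticResidueSymbol v₅ (Ideal.Quotient.mk v₅.asIdeal α) : 𝓞 K3) : K3) ^ 3 := by
  haveI : Fact (Nat.Prime 5) := ⟨by norm_num⟩
  haveI := charP_five hv
  letI := Ideal.Quotient.field v₅.asIdeal
  have hζ6 := isPrimitiveRoot_neg_of_isPrimitiveRoot_three EisensteinGrossen.hζ
  obtain ⟨h2₅, h3₅⟩ := two_three_not_mem_of_five_mem hv
  set n : ℕ := Ideal.absNorm (Ideal.span {α}) with hn
  have hα0 : Ideal.Quotient.mk v₅.asIdeal α ≠ 0 := fun h ↦ hα (Ideal.Quotient.eq_zero_iff_mem.mp h)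
  -- `(5/n) = (n/5) = legendreSym 5 n`
  have hα00 : α ≠ 0 := fun h ↦ hα (h ▸ v₅.asIdeal.zero_mem)
  have hQR : jacobiSym 5 n = legendreSym 5 n := by
    rw [jacobiSym.legendreSym.to_jacobiSym, hn, jacobiSym_absNorm_flip (u := 5) (by norm_num) hα00]
    rfl
  -- Euler's criterion read in `𝓞 K3 ⧸ (5)`: `legendreSym 5 n ≡ n² ≡ α¹²`
  have hn5 : ((n : ℤ) : ZMod 5) ≠ 0 := by
    rw [Ne, ZMod.intCast_zmod_eq_zero_iff_dvd]
    exact not_five_dvd_absNorm hv hα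
  have hE : Ideal.Quotient.mk v₅.asIdeal ((legendreSym 5 n : ℤ) : 𝓞 K3) = Ideal.Quotient.mk v₅.asIdeal α ^ 12 := by
    have h1 : Ideal.Quotient.mk v₅.asIdeal ((legendreSym 5 n : ℤ) : 𝓞 K3) =
        ZMod.castHom (dvd_refl 5) (𝓞 K3 ⧸ v₅.asIdeal) (legendreSym 5 n : ZMod 5) := by
      rw [map_intCast, map_intCast]
    have h2 : ((n : ℤ) : 𝓞 K3 ⧸ v₅.asIdeal) = Ideal.Quotient.mk v₅.asIdeal ((n : ℕ) : 𝓞 K3) := by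
      rw [map_natCast, Int.cast_natCast]
    rw [h1, legendreSym.eq_pow, map_pow, map_intCast, show (5 / 2 : ℕ) = 2 by norm_num, h2, hn, mk_absNorm_eq_pow_six hv, ← pow_mul]
  -- the sextic symbol cubed: `≡ α^{12}`
  set μ := sexticResidueSymbol v₅ (Ideal.Quotient.mk v₅.asIdeal α) with hμ
  have hS : Ideal.Quotient.mk v₅.asIdeal (μ ^ 3) = Ideal.Quotient.mk v₅.asIdeal α ^ 12 := by
    rw [hμ, mk_sexticResidueSymbol_pow_three hζ6 h2₅ h3₅ hα0, residueCard_eq_of_five_mem hv]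
    norm_num
  -- both are `±1`, congruent mod `5`, hence equal
  have hL : legendreSym 5 n = 1 ∨ legendreSym 5 n = -1 := legendreSym.eq_one_or_neg_one 5 hn5
  have hM : μ ^ 3 = 1 ∨ μ ^ 3 = -1 := sexticResidueSymbol_pow_three_eq_one_or hζ6 h2₅ h3₅ hα0
  have hne : Ideal.Quotient.mk v₅.asIdeal (1 : 𝓞 K3) ≠ Ideal.Quotient.mk v₅.asIdeal (-1 : 𝓞 K3) := by
    intro h
    rw [Ideal.Quotient.eq, sub_neg_eq_add, one_add_one_eq_two] at h
    exact h2₅ h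
  have hEq : ((legendreSym 5 n : ℤ) : 𝓞 K3) = μ ^ 3 := by
    have hc : Ideal.Quotient.mk v₅.asIdeal ((legendreSym 5 n : ℤ) : 𝓞 K3) = Ideal.Quotient.mk v₅.asIdeal (μ ^ 3) := by
      rw [hE, hS]
    rcases hL with h | h <;> rcases hM with h' | h'
    · rw [h, h']; push_cast; rfl
    · rw [h, h', Int.cast_one] at hc; exact absurd hc hne
    · rw [h, h', Int.cast_neg, Int.cast_one] at hc; exact absurd hc.symm hne
    · rw [h, h']; push_cast; rfl
  rw [hQR]
  calc ((legendreSym 5 n : ℤ) : ℂ) = embC (((legendreSym 5 n : ℤ) : 𝓞 K3) : K3) := by simp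
    _ = embC ((μ ^ 3 : 𝓞 K3) : K3) := by rw [hEq]
    _ = embC (μ : K3) ^ 3 := by push_cast; rw [map_pow]

/-- **The `5`-part of the weight, good-at-`2` class**: for `u = 5^e u₁` (`e ≥ 1`) and every `x ∈ ℤ[ω]`,
`W′_u(x) = \overline{e((x/5)₆)}^e · W′_{u₁}(x)`, where `W′_u(x) = 𝟙[x ≡ 1 (3)] c(N x) (u/N x) ν_u((x))` is the weight of
`SexticTwistThetaDictionaryGoodTwo` (even norms allowed: `(5/N x) = e((x/5)₆)³` for all `5 ∤ x`).
[cite: IrelandRosen1990, Ch. 18 §7 and Ch. 9 §3 Theorem 1] [cite: IrelandRosen1982, Ch. 14 §2, Prop. 14.2.2] -/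
theorem weight_five_split_good {m : ℕ} (c : ZMod m → ℂ) {e : ℕ} (he : 1 ≤ e) {k₁ : ℤ} (x : 𝓞 K3) :
    (if x - 1 ∈ three then c ((Ideal.absNorm (Ideal.span {x}) : ℕ) : ZMod m) *
        (jacobiSym (5 ^ e * k₁) (Ideal.absNorm (Ideal.span {x})) : ℂ) * grossenNu ((5 ^ e * k₁ : ℤ) : 𝓞 K3) 1 0 (Ideal.span {x})
      else 0) =
      conj (embC ((sexticResidueSymbol v₅ (Ideal.Quotient.mk v₅.asIdeal x) : 𝓞 K3) : K3)) ^ e *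
        (if x - 1 ∈ three then c ((Ideal.absNorm (Ideal.span {x}) : ℕ) : ZMod m) *
          (jacobiSym k₁ (Ideal.absNorm (Ideal.span {x})) : ℂ) * grossenNu ((k₁ : ℤ) : 𝓞 K3) 1 0 (Ideal.span {x}) else 0) := by
  letI := Ideal.Quotient.field v₅.asIdeal
  have hζ6 := isPrimitiveRoot_neg_of_isPrimitiveRoot_three EisensteinGrossen.hζ
  obtain ⟨h2₅, h3₅⟩ := two_three_not_mem_of_five_mem hv
  obtain ⟨e, rfl⟩ : ∃ e', e = e' + 1 := ⟨e - 1, by omega⟩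
  set D₅ : 𝓞 K3 := ((5 : ℤ) : 𝓞 K3) with hD₅
  set D₁ : 𝓞 K3 := ((k₁ : ℤ) : 𝓞 K3) with hD₁
  have hD : ((5 ^ (e + 1) * k₁ : ℤ) : 𝓞 K3) = D₅ ^ (e + 1) * D₁ := by rw [hD₅, hD₁]; push_cast; ring
  by_cases h1 : x - 1 ∈ three
  swap
  · rw [if_neg h1, if_neg h1, mul_zero]
  rw [if_pos h1, if_pos h1]
  by_cases hx : x ∈ v₅.asIdeal
  · -- `5 ∣ x`: both sides vanish
    have h0 : Ideal.Quotient.mk v₅.asIdeal x = 0 := Ideal.Quotient.eq_zero_iff_mem.mpr hx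
    have hnadm : ¬ Adm ((5 ^ (e + 1) * k₁ : ℤ) : 𝓞 K3) (Ideal.span {x}) := by
      rintro ⟨-, hcop⟩
      rw [Ideal.isCoprime_iff_sup_eq] at hcop
      have hle : Ideal.span {x} ⊔ Ideal.span {3 * (((5 ^ (e + 1) * k₁ : ℤ) : 𝓞 K3))} ≤ v₅.asIdeal := by
        refine sup_le ((Ideal.span_singleton_le_iff_mem _).mpr hx) ((Ideal.span_singleton_le_iff_mem _).mpr ?_)
        have : (3 : 𝓞 K3) * ((5 ^ (e + 1) * k₁ : ℤ) : 𝓞 K3) = ((3 * 5 ^ e * k₁ : ℤ) : 𝓞 K3) * ((5 : ℤ) : 𝓞 K3) := by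
          push_cast; ring
        rw [this]
        exact v₅.asIdeal.mul_mem_left _ hv
      rw [hcop, top_le_iff] at hle
      exact v₅.isPrime.ne_top hle
    rw [grossenNu_apply, if_neg hnadm, h0, sexticResidueSymbol_zero hζ6 h2₅ h3₅, mul_zero]
    simp
  by_cases hadm : Adm D₁ (Ideal.span {x})
  swap
  · -- not admissible for `4k₁`: both sides vanish
    have hnadm : ¬ Adm ((5 ^ (e + 1) * k₁ : ℤ) : 𝓞 K3) (Ideal.span {x}) := by
      rw [hD]; exact fun h ↦ hadm (adm_of_adm_mul_left h).2
    rw [grossenNu_apply, if_neg hnadm, grossenNu_apply, if_neg hadm, mul_zero, mul_zero, mul_zero]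
  -- the admissible case
  have hx0 : x ≠ 0 := fun h ↦ hx (h ▸ v₅.asIdeal.zero_mem)
  have h3x : IsCoprime (Ideal.span {x}) three := hadm.coprime_three
  have hadm5 : Adm D₅ (Ideal.span {x}) := by
    refine ⟨by rwa [Ne, Ideal.span_singleton_eq_bot], ?_⟩
    rw [show Ideal.span {3 * D₅} = three * Ideal.span {D₅} from (Ideal.span_singleton_mul_span_singleton _ _).symm]
    exact IsCoprime.mul_right h3x (by have h := isCoprime_span_five_pow hv hx 1; rwa [pow_one] at h)
  have hadmk : Adm (D₅ ^ (e + 1) * D₁) (Ideal.span {x}) := by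
    refine ⟨hadm.1, ?_⟩
    rw [show Ideal.span {3 * (D₅ ^ (e + 1) * D₁)} = Ideal.span {3 * D₁} * Ideal.span {D₅} ^ (e + 1) by
      rw [Ideal.span_singleton_pow, Ideal.span_singleton_mul_span_singleton]; ring_nf]
    exact IsCoprime.mul_right hadm.2 (isCoprime_span_five_pow hv hx (e + 1))
  -- `ν_{4k} = ν_5^(e+1) ν_{4k₁}` and `ν_5((x)) = e((x/5)₆)²`
  have hν : grossenNu ((5 ^ (e + 1) * k₁ : ℤ) : 𝓞 K3) 1 0 (Ideal.span {x}) =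
      embC ((sexticResidueSymbol v₅ (Ideal.Quotient.mk v₅.asIdeal x) : 𝓞 K3) : K3) ^ (2 * (e + 1)) *
        grossenNu D₁ 1 0 (Ideal.span {x}) := by
    rw [hD, grossenNu_mul_left _ _ _ hadmk, grossenNu_pow_left _ _ hadm5, grossenNu_apply, if_pos hadm5, pow_one, sectorWeight,
      pow_zero, mul_one, hD₅, psi_five_eq_cubicResidueSymbol_primGen hv _ hadm5, primGen_span_singleton h1,
      ← sexticResidueSymbol_sq hζ6 h2₅ h3₅, pow_mul]
    push_cast
    rw [map_pow]
  -- `(5^(e+1) k₁ / N x) = e((x/5)₆)^(3(e+1)) (k₁ / N x)`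
  have hJ : (jacobiSym (5 ^ (e + 1) * k₁) (Ideal.absNorm (Ideal.span {x})) : ℂ) =
      embC ((sexticResidueSymbol v₅ (Ideal.Quotient.mk v₅.asIdeal x) : 𝓞 K3) : K3) ^ (3 * (e + 1)) *
        (jacobiSym k₁ (Ideal.absNorm (Ideal.span {x})) : ℂ) := by
    rw [jacobiSym.mul_left, jacobiSym.pow_left, Int.cast_mul, Int.cast_pow, jacobiSym_five_absNorm_eq_of_not_mem hv hx, ← pow_mul]
  -- `e((x/5)₆)⁵ = conj e((x/5)₆)`
  set E : ℂ := embC ((sexticResidueSymbol v₅ (Ideal.Quotient.mk v₅.asIdeal x) : 𝓞 K3) : K3) with hE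
  have hx0' : Ideal.Quotient.mk v₅.asIdeal x ≠ 0 := fun h ↦ hx (Ideal.Quotient.eq_zero_iff_mem.mp h)
  have hE6 : E ^ 6 = 1 := by
    have h6 := (sexticResidueSymbol_spec hζ6 h2₅ h3₅ hx0').1
    have : ((sexticResidueSymbol v₅ (Ideal.Quotient.mk v₅.asIdeal x) ^ 6 : 𝓞 K3) : K3) = 1 := by rw [h6]; rfl
    rw [hE, ← map_pow]
    push_cast at this
    rw [this, map_one]
  have hE5 : E ^ 5 = conj E := by
    have hEne : E ≠ 0 := fun h ↦ by rw [h] at hE6; norm_num at hE6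
    rw [conj_eq_inv_of_pow_eq_one (by norm_num) hE6]
    exact eq_inv_of_mul_eq_one_left (by rw [← pow_succ, hE6])
  rw [hJ, hν, ← hE5]
  ring

/-- **The `5`-part in QuadOrder's `ℤ²`-coordinates, good-at-`2` class**: with `Φ_k(y) = W_k(y₁ − y₂ζ)` (the `Φ` of `lSeries_twist_eq_thetaLFunction`, `γ_y = y₁ + y₂ω₃ =
\overline{e(y₁ − y₂ζ)} = e(y₂ζ + (y₁ + y₂))`): `Φ_k(y) = Φ₅(y₂, y₁ + y₂) · Φ_{k₁}(y)` for `k = 5^e k₁`, where `Φ₅(c₁, c₂) = e(((c₁ζ + c₂)/5)₆)^e`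
(`\overline{e((τγ/5)₆)} = e((γ/5)₆)`). [cite: IrelandRosen1990, Ch. 18 §7] [cite: IrelandRosen1982, Ch. 14 §2, Prop. 14.2.2] -/
theorem thetaWeight_five_split_good {m : ℕ} (c : ZMod m → ℂ) {e : ℕ} (he : 1 ≤ e) {k₁ : ℤ} (y : ℤ × ℤ) :
    (fun x : 𝓞 K3 ↦ if x - 1 ∈ three then c ((Ideal.absNorm (Ideal.span {x}) : ℕ) : ZMod m) *
        (jacobiSym (5 ^ e * k₁) (Ideal.absNorm (Ideal.span {x})) : ℂ) * grossenNu ((5 ^ e * k₁ : ℤ) : 𝓞 K3) 1 0 (Ideal.span {x})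
        else 0) (mkInt y.1 (-y.2)) =
      (fun c : ZMod 5 × ZMod 5 ↦ embC ((sexticResidueSymbol v₅ (Ideal.Quotient.mk v₅.asIdeal (mkInt (c.2.val : ℤ) (c.1.val : ℤ))) :
          𝓞 K3) : K3) ^ e) ((y.2 : ZMod 5), ((y.1 + y.2 : ℤ) : ZMod 5)) *
        (fun x : 𝓞 K3 ↦ if x - 1 ∈ three then c ((Ideal.absNorm (Ideal.span {x}) : ℕ) : ZMod m) *
          (jacobiSym k₁ (Ideal.absNorm (Ideal.span {x})) : ℂ) * grossenNu ((k₁ : ℤ) : 𝓞 K3) 1 0 (Ideal.span {x}) else 0)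
          (mkInt y.1 (-y.2)) := by
  simp only
  rw [weight_five_split_good hv c he (mkInt y.1 (-y.2)), ← embC_sexticResidueSymbol_tau hv, tau_mkInt]
  have hcl : Ideal.Quotient.mk v₅.asIdeal (mkInt (y.1 - -y.2) (-(-y.2))) =
      Ideal.Quotient.mk v₅.asIdeal (mkInt ((((y.1 + y.2 : ℤ) : ZMod 5)).val : ℤ) (((y.2 : ZMod 5)).val : ℤ)) := by
    rw [show y.1 - -y.2 = y.1 + y.2 by ring, neg_neg]
    exact mk_mkInt_eq_of_emod_eq hv (by rw [ZMod.val_intCast]; omega) (by rw [ZMod.val_intCast]; omega)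
  rw [hcl]


end Split

section Main

variable {k : ℤ} {m : ℕ}

/-- `u = 5^e · u₁` with `5 ∤ u₁`, for `u ≠ 0`. [cite: IrelandRosen1990, Ch. 18 §7] -/
private theorem exists_eq_five_pow_mul' {u : ℤ} (hu : u ≠ 0) : ∃ (e : ℕ) (u₁ : ℤ), u = 5 ^ e * u₁ ∧ ¬ (5 : ℤ) ∣ u₁ := by
  obtain ⟨e, n', hn', hkn⟩ := Nat.exists_eq_pow_mul_and_not_dvd (Int.natAbs_ne_zero.mpr hu) 5 (by norm_num)
  have hn'' : ¬ (5 : ℤ) ∣ (n' : ℤ) := by exact_mod_cast hn'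
  rcases Int.natAbs_eq u with h | h
  · refine ⟨e, n', ?_, hn''⟩
    conv_lhs => rw [h, hkn]
    push_cast; ring
  · refine ⟨e, -n', ?_, by rwa [dvd_neg]⟩
    conv_lhs => rw [h, hkn]
    push_cast
    ring

/-- ★ **The `hdict` input of the `j = 0` supercuspidal cell, good-at-`2` class: Theorem 18.7 for `y² = x³ + 16u`, `u ≡ 1 (4)`, `5 ∣ u`,
at level `5 · M′` with the sextic character at `5` split off.**  For `k = 16u` sixth-power-free, `5 ∣ k`, `m ≥ 1` prime to `5` and
`c : ℤ/m → ℂ`: there are `e = v₅(u) ∈ [1, 5]`, `u₁ = u/5^e`, `M′ = 36|u₁|m` (prime to `5`), the character `Φ₅(c₁, c₂) = e(((c₁ρ + c₂)/5)₆)^e` of `(ℤ/5)²` (multiplicative,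
`Φ₅(0) = 0`, `Φ₅(1 − ρ) = (−ρ²)^e`, algebraic-integer values) and the weight `Ψ = Φ_{k₁}` (periodic modulo `M′`, algebraic-integer values when `c`
has them, given by the explicit formula of `SexticTwistThetaDictionaryGoodTwo` for `u₁`) with, for `re s > 3/2`,
`Σ_n c(n) a_n(E^k) n⁻ˢ = (4^s/2) · BinaryTheta.thetaLFunction 3 (2·(5M′)) 1 (−√3 i) (parityLift (y ↦ Φ₅(y₂, y₁ + y₂) Ψ(y))) s`
(QuadOrder coordinates `γ_y = y₁ + y₂ω₃ = y₂ρ + (y₁ + y₂)`). [cite: IrelandRosen1990, Ch. 18 §7 and §5 Theorem 6] [cite: Hecke1920, §9] -/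
theorem lSeries_twist_eq_thetaLFunction_five_good {u : ℤ} (hu4 : u % 4 = 1) (hku : k = 16 * u)
    (h6 : ∀ q : ℕ, q.Prime → ¬ (q : ℤ) ^ 6 ∣ k) (h5 : (5 : ℤ) ∣ k) [NeZero m] (h5m : ¬ 5 ∣ m) (c : ZMod m → ℂ) :
    ∃ (e : ℕ) (u₁ : ℤ) (M' : ℕ) (_ : NeZero M') (_ : NeZero (2 * (5 * M'))) (Φ₅ : ZMod 5 × ZMod 5 → ℂ) (Ψ : ℤ × ℤ → ℂ),
      1 ≤ e ∧ e ≤ 5 ∧ u = 5 ^ e * u₁ ∧ ¬ (5 : ℤ) ∣ u₁ ∧ M' = 36 * u₁.natAbs * m ∧ Nat.Coprime 5 M' ∧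
      Φ₅ 0 = 0 ∧
      (∀ d d' : ZMod 5 × ZMod 5, Φ₅ (d.1 * d'.2 + d.2 * d'.1 - d.1 * d'.1, d.2 * d'.2 - d.1 * d'.1) = Φ₅ d * Φ₅ d') ∧
      Φ₅ (-1, 1) = (-(UpperHalfPlane.ρ : ℂ) ^ 2) ^ e ∧
      (∀ d : ZMod 5 × ZMod 5, IsIntegral ℤ (Φ₅ d)) ∧
      (∀ y z : ℤ × ℤ, Ψ (y.1 + M' * z.1, y.2 + M' * z.2) = Ψ y) ∧
      ((∀ a, IsIntegral ℤ (c a)) → ∀ y : ℤ × ℤ, IsIntegral ℤ (Ψ y)) ∧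
      (∀ y : ℤ × ℤ, Ψ y = (fun x : 𝓞 K3 ↦ if x - 1 ∈ three then c ((Ideal.absNorm (Ideal.span {x}) : ℕ) : ZMod m) *
          (jacobiSym u₁ (Ideal.absNorm (Ideal.span {x})) : ℂ) * grossenNu ((u₁ : ℤ) : 𝓞 K3) 1 0 (Ideal.span {x}) else 0)
          (mkInt y.1 (-y.2))) ∧
      ∀ s : ℂ, 3 / 2 < s.re →
        LSeries (fun n : ℕ ↦ c (n : ZMod m) * ((mordellCurve (k : ℚ)).LFunction n : ℂ)) s =
          (4 : ℂ) ^ s / 2 * BinaryTheta.thetaLFunction 3 (2 * (5 * M')) 1 (-((Real.sqrt 3 : ℂ) * I))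
            (QuadOrder.parityLift fun y : ℤ × ℤ ↦ Φ₅ ((y.2 : ZMod 5), ((y.1 + y.2 : ℤ) : ZMod 5)) * Ψ y) s := by
  have hu0 : u ≠ 0 := by rintro rfl; omega
  obtain ⟨e, k₁, hke, hk₁⟩ := exists_eq_five_pow_mul' hu0
  have h5u : (5 : ℤ) ∣ u := by
    rw [hku] at h5
    rcases (Nat.prime_iff_prime_int.mp (by norm_num : Nat.Prime 5)).dvd_or_dvd h5 with h | h
    · norm_num at h
    · exact h
  have he1 : 1 ≤ e := by
    by_contra h0
    have : e = 0 := by omega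
    subst this
    rw [pow_zero, one_mul] at hke
    exact hk₁ (hke ▸ h5u)
  have he5 : e ≤ 5 := by
    by_contra h
    refine h6 5 (by norm_num) ?_
    rw [hku, hke]
    exact ((pow_dvd_pow (5 : ℤ) (by omega)).mul_right k₁).mul_left 16
  have hk₁0 : k₁ ≠ 0 := by rintro rfl; exact hu0 (by rw [hke, mul_zero])
  have hk₁4 : k₁ % 4 = 1 := by
    have h5e : ∀ n : ℕ, (5 : ℤ) ^ n % 4 = 1 := by
      intro n
      induction n with
      | zero => norm_num
      | succ n ih => rw [pow_succ, Int.mul_emod, ih]; norm_num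
    have := hu4
    rw [hke, Int.mul_emod, h5e, one_mul, Int.emod_emod_of_dvd _ (dvd_refl (4 : ℤ))] at this
    exact this
  subst hke
  -- the prime `(5)`
  set v₅ : HeightOneSpectrum (𝓞 K3) := primeOf (prime_natCast_of_mod_three_eq_two (by norm_num : Nat.Prime 5) (by norm_num))
    with hv₅
  have hv : ((5 : ℤ) : 𝓞 K3) ∈ v₅.asIdeal := Ideal.mem_span_singleton_self _
  -- the level `M' = 36 |k₁| m`
  set M' : ℕ := 36 * k₁.natAbs * m with hM'
  haveI hM'0 : NeZero M' :=
    ⟨by rw [hM']; exact Nat.mul_ne_zero (Nat.mul_ne_zero (by norm_num) (Int.natAbs_ne_zero.mpr hk₁0)) (NeZero.ne m)⟩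
  haveI h10M : NeZero (2 * (5 * M')) := ⟨Nat.mul_ne_zero two_ne_zero (Nat.mul_ne_zero (by norm_num) (NeZero.ne M'))⟩
  have hcop : Nat.Coprime 5 M' := by
    rw [hM', Nat.Prime.coprime_iff_not_dvd (by norm_num : Nat.Prime 5)]
    intro h
    rcases (Nat.Prime.dvd_mul (by norm_num : Nat.Prime 5)).mp h with h36 | hm
    · rcases (Nat.Prime.dvd_mul (by norm_num : Nat.Prime 5)).mp h36 with h36' | hk'
      · norm_num at h36'
      · exact hk₁ (Int.ofNat_dvd_left.mpr hk')
    · exact h5m hm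
  -- the two factors
  set Φ₅ : ZMod 5 × ZMod 5 → ℂ := fun c : ZMod 5 × ZMod 5 ↦
    embC ((sexticResidueSymbol v₅ (Ideal.Quotient.mk v₅.asIdeal (mkInt (c.2.val : ℤ) (c.1.val : ℤ))) : 𝓞 K3) : K3) ^ e with hΦ₅
  set W₁ : 𝓞 K3 → ℂ := fun x : 𝓞 K3 ↦ if x - 1 ∈ three then c ((Ideal.absNorm (Ideal.span {x}) : ℕ) : ZMod m) *
      (jacobiSym k₁ (Ideal.absNorm (Ideal.span {x})) : ℂ) * grossenNu ((k₁ : ℤ) : 𝓞 K3) 1 0 (Ideal.span {x}) else 0 with hW₁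
  set W : 𝓞 K3 → ℂ := fun x : 𝓞 K3 ↦ if x - 1 ∈ three then c ((Ideal.absNorm (Ideal.span {x}) : ℕ) : ZMod m) *
      (jacobiSym (5 ^ e * k₁) (Ideal.absNorm (Ideal.span {x})) : ℂ) * grossenNu ((5 ^ e * k₁ : ℤ) : 𝓞 K3) 1 0 (Ideal.span {x})
      else 0 with hW
  set Ψ : ℤ × ℤ → ℂ := fun y : ℤ × ℤ ↦ W₁ (mkInt y.1 (-y.2)) with hΨdef
  obtain ⟨hΦ0, hΦmul, hΦgen, hΦint⟩ := sexticCharFive_props hv he1 (e := e)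
  -- periodicity of `Ψ` modulo `M'`
  have hΨ : ∀ y z : ℤ × ℤ, Ψ (y.1 + M' * z.1, y.2 + M' * z.2) = Ψ y := by
    intro y z
    have h := weight_periodic_good k₁ m c hk₁4 (mkInt y.1 (-y.2)) (mkInt z.1 (-z.2))
    change W₁ (mkInt y.1 (-y.2) + ((36 * k₁.natAbs * m : ℕ) : 𝓞 K3) * mkInt z.1 (-z.2)) = W₁ (mkInt y.1 (-y.2)) at h
    have eq : mkInt y.1 (-y.2) + ((36 * k₁.natAbs * m : ℕ) : 𝓞 K3) * mkInt z.1 (-z.2) = mkInt (y.1 + M' * z.1) (-(y.2 + M' * z.2)) := by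
      rw [← hM', show ((M' : ℕ) : 𝓞 K3) = mkInt M' 0 by rw [mkInt_intCast]; push_cast; rfl, mkInt_mul, mkInt_add]
      congr 1 <;> ring
    rw [eq] at h
    exact h
  -- the factorisation and the `5M'`-periodicity of the full weight
  have hfac : (fun y : ℤ × ℤ ↦ Φ₅ ((y.2 : ZMod 5), ((y.1 + y.2 : ℤ) : ZMod 5)) * Ψ y) = fun y : ℤ × ℤ ↦ W (mkInt y.1 (-y.2)) :=
    funext fun y ↦ (thetaWeight_five_split_good hv c he1 (k₁ := k₁) y).symm
  have hΘ : ∀ y z : ℤ × ℤ, (fun y : ℤ × ℤ ↦ Φ₅ ((y.2 : ZMod 5), ((y.1 + y.2 : ℤ) : ZMod 5)) * Ψ y) (y.1 + (5 * M' : ℕ) * z.1,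
      y.2 + (5 * M' : ℕ) * z.2) = (fun y : ℤ × ℤ ↦ Φ₅ ((y.2 : ZMod 5), ((y.1 + y.2 : ℤ) : ZMod 5)) * Ψ y) y := by
    intro y z
    simp only
    have h50 : (5 : ZMod 5) = 0 := by decide
    have h1 : ((y.2 + (5 * M' : ℕ) * z.2 : ℤ) : ZMod 5) = (y.2 : ZMod 5) := by
      push_cast; rw [h50]; ring
    have h2 : ((y.1 + (5 * M' : ℕ) * z.1 + (y.2 + (5 * M' : ℕ) * z.2) : ℤ) : ZMod 5) = ((y.1 + y.2 : ℤ) : ZMod 5) := by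
      push_cast; rw [h50]; ring
    have h3 : Ψ (y.1 + (5 * M' : ℕ) * z.1, y.2 + (5 * M' : ℕ) * z.2) = Ψ y := by
      have := hΨ y (5 * z.1, 5 * z.2)
      simp only at this
      rw [← this]
      congr 1
      · push_cast; ring
    rw [h1, h2, h3]
  refine ⟨e, k₁, M', hM'0, h10M, Φ₅, Ψ, he1, he5, rfl, hk₁, rfl, hcop, hΦ0, hΦmul, hΦgen, hΦint, hΨ,
    fun hc y ↦ isIntegral_weight_good k₁ m c hc _, fun y ↦ rfl, fun s hs ↦ ?_⟩
  rw [BinaryTheta.thetaLFunction_eq_LSeries 3 (2 * (5 * M')) 1 _ _ (QuadOrder.parityLift_periodic (5 * M') _ hΘ) hs, hfac,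
    lSeries_coeff_parityLift W s, LSeries_congr (fun {n} _ ↦ sum_normEq_weight_good_eq hu4 hku h6 c n) s]
  have h4 : (4 : ℂ) ^ s ≠ 0 := by
    rw [Ne, cpow_eq_zero_iff, not_and_or]; exact Or.inl (by norm_num)
  rw [cpow_neg]
  field_simp

end Main

end SexticTwist

end Literature.NumberTheory.EllipticCurves

end
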